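/- WIDTH SEAT `ym-line-cbag-p1-w3` (prover-ym-line-cbag-p1-w3-g12-0), route `EguchiKawaiDirectionLadder` (ideator ym-idea-2, LINE 8),
crux `TripleSmallBallMargin` (stmt-QuantumFields-27724), LEAD g24's v7 architecture, stubs S7/S8 PACKAGED in the LEAD's currency
(`…RigidityDefs`): the rank-robust ENTRYWISE RIGIDITY (E_rob) and the rank-robust PAIR SMALL BALL (Ψ_rob) as unconditional
theorems, from S7 (`RankRobust.haar_rankRobust_le`), S8 (`RankRobust.ekHaar_two_rankRobust_le_ekAction`), S1/S2
(`entrywiseRigidity_holds`) and S4 (`pairSmallBall_of_entrywiseRigidity`).  ROUTE-INDEPENDENT (no Theses import).  Nothing here bears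
on the Yang–Mills mass gap (barrier-ledger line onto `EguchiKawaiBreakdown`). -/
import Summits.QuantumFields.YangMills.Theorems.EguchiKawaiDirectionLadderRankRobustPair
import Summits.QuantumFields.YangMills.Theorems.EguchiKawaiDirectionLadderPairSmallBall
import Summits.QuantumFields.YangMills.Theorems.EguchiKawaiDirectionLadderEntrywiseRigidityCircle

/-!
# Route `EguchiKawaiDirectionLadder`, stubs S7/S8 packaged: rank-robust rigidity and rank-robust pair small ball

* `const_eq_exp` — `33^{N²}(100/t²)^{sN} = exp(N² log 33 + sN (log 100 − 2 log t))`.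
* `entrywiseRigidity_robust` (E_rob) — for every `η > 0` there are `κ ≥ 1`, `C ≥ 0`, `N₀` with: for `N ≥ N₀`, `0 < t ≤ 1`, every
  DIAGONAL unitary `D = diag(d)` and every `s ≤ N`,
  `Haar{W : ∃ R, rank R ≤ s, ‖DW − WD − R‖_F² ≤ N t} ≤ exp(N²(C − η log t) + sN(log 100 − 2 log t)) · ∏_{j<k} pairFactor (κt) |d_j − d_k|²`.
* `pairSmallBall_robust` (Ψ_rob) — for every `η > 0` there are `C ≥ 0`, `N₀` with: for `N ≥ N₀`, `0 < t ≤ 1`, `s ≤ N`,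
  `ekHaar 2 N {U : ∃ R, rank R ≤ s, ‖[U₀,U₁] − R‖_F² ≤ N t} ≤ exp(N²(C − η log t) + sN(log 100 − 2 log t)) · t^{C(N,2)}`.

At rank `s = κ′N` the extra factor is `exp(N²(κ′ log 100 − 2κ′ log t))` — the `−O(κ′) log t` loss of ARCH-27724-lead-g24 §3.  Proofs:
S7/S8 turn the robust event into the plain one at precision `18t` (`‖DW − WD‖_F² ≤ 36Nt ⟺ S_R ≤ 18t`); for `18t ≤ 1` apply
(E)/(Ψ) there (`log(18t) = log 18 + log t`, `18^{C(N,2)} ≤ e^{N² log 18}`, `pairFactor` monotone in the budget); for `18t > 1` the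
bound is `≥ 1`.  All [folklore].
-/

set_option autoImplicit false

noncomputable section

open MeasureTheory
open scoped Matrix ENNReal
open Literature.Barriers.QuantumFields
open Literature.MathematicalPhysics.QuantumFieldTheory (haarProbability)

namespace Summit.QuantumFields.YangMills.Theorems.EguchiKawaiDirectionLadder

namespace RankRobust

variable {N : ℕ}

/-! ### Constants -/

/-- `33^{N²}·(100/t²)^{sN} = exp(N² log 33 + sN (log 100 − 2 log t))` for `t > 0`. -/
theorem const_eq_exp (N s : ℕ) {t : ℝ} (ht : 0 < t) :
    (33 : ℝ) ^ (N * N) * (100 / t ^ 2) ^ (s * N) =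
      Real.exp ((N : ℝ) ^ 2 * Real.log 33 + (s : ℝ) * N * (Real.log 100 - 2 * Real.log t)) := by
  have h1 : (33 : ℝ) ^ (N * N) = Real.exp ((N : ℝ) ^ 2 * Real.log 33) := by
    rw [show ((N : ℝ) ^ 2 * Real.log 33) = ((N * N : ℕ) : ℝ) * Real.log 33 by push_cast; ring,
      Real.exp_nat_mul, Real.exp_log (by norm_num : (0 : ℝ) < 33)]
  have h2 : (100 / t ^ 2 : ℝ) ^ (s * N) = Real.exp ((s : ℝ) * N * (Real.log 100 - 2 * Real.log t)) := by
    have hlog : Real.log (100 / t ^ 2) = Real.log 100 - 2 * Real.log t := by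
      rw [Real.log_div (by norm_num) (by positivity), Real.log_pow]; push_cast; ring
    rw [show ((s : ℝ) * N * (Real.log 100 - 2 * Real.log t)) = ((s * N : ℕ) : ℝ) * Real.log (100 / t ^ 2) by
        rw [hlog]; push_cast; ring,
      Real.exp_nat_mul, Real.exp_log (by positivity)]
  rw [h1, h2, ← Real.exp_add]

/-- `18^{C(N,2)} ≤ exp(N² log 18)`. -/
theorem eighteen_pow_choose_two_le (N : ℕ) : (18 : ℝ) ^ N.choose 2 ≤ Real.exp ((N : ℝ) ^ 2 * Real.log 18) := by
  rw [show (18 : ℝ) ^ N.choose 2 = Real.exp ((N.choose 2 : ℕ) * Real.log 18) by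
    rw [Real.exp_nat_mul, Real.exp_log (by norm_num : (0 : ℝ) < 18)]]
  refine Real.exp_le_exp.2 (mul_le_mul_of_nonneg_right (cast_choose_two_le_sq N) (Real.log_nonneg (by norm_num)))

/-- For `0 < t ≤ 1`: `t^{C(N,2)} ≥ exp(N² log t)` (`C(N,2) ≤ N²`, `log t ≤ 0`). -/
theorem exp_sq_mul_log_le_pow_choose_two (N : ℕ) {t : ℝ} (ht : 0 < t) (ht1 : t ≤ 1) :
    Real.exp ((N : ℝ) ^ 2 * Real.log t) ≤ t ^ N.choose 2 := by
  rw [show t ^ N.choose 2 = Real.exp ((N.choose 2 : ℕ) * Real.log t) by rw [Real.exp_nat_mul, Real.exp_log ht]]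
  refine Real.exp_le_exp.2 ?_
  have hlog : Real.log t ≤ 0 := Real.log_nonpos ht.le ht1
  have hc := cast_choose_two_le_sq N
  nlinarith

/-! ### The plain events at precision `18t` -/

/-- `ekComm ![D, W] 0 1 = DW − WD`. -/
theorem ekComm_vecCons (D W : UN N) :
    ekComm ((![D, W] : EKConfig 2 N)) 0 1 =
      (D : Matrix (Fin N) (Fin N) ℂ) * (W : Matrix (Fin N) (Fin N) ℂ) -
        (W : Matrix (Fin N) (Fin N) ℂ) * (D : Matrix (Fin N) (Fin N) ℂ) := rfl

/-- `{W : ‖DW − WD‖_F² ≤ 36 N t} = {W : S_R(D, W) ≤ 18 t}` (`N ≥ 1`). -/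
theorem plainEvent_eq_ekAction (hN : 0 < N) (D : UN N) (t : ℝ) :
    {W : UN N | frobSq ((D : Matrix (Fin N) (Fin N) ℂ) * (W : Matrix (Fin N) (Fin N) ℂ) -
        (W : Matrix (Fin N) (Fin N) ℂ) * (D : Matrix (Fin N) (Fin N) ℂ)) ≤ 36 * ((N : ℝ) * t)} =
      {W : UN N | ekAction ((![D, W] : EKConfig 2 N)) ≤ 18 * t} := by
  ext W
  rw [Set.mem_setOf_eq, Set.mem_setOf_eq, ← frobSq_ekComm_le_iff_ekAction_le hN _ (18 * t), ekComm_vecCons]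
  constructor <;> intro h <;> nlinarith

/-! ### (E_rob): rank-robust entrywise rigidity -/

/-- **Rank-robust entrywise rigidity (E_rob), packaged.**  For every `η > 0` there are `κ ≥ 1`, `C ≥ 0`, `N₀` such that for
`N ≥ N₀`, `0 < t ≤ 1`, every diagonal unitary `D = diag(d)` and every `s ≤ N`:
`Haar{W : ∃ R, rank R ≤ s, ‖DW − WD − R‖_F² ≤ N t} ≤ exp(N²(C − η log t) + sN(log 100 − 2 log t)) · ∏_{j<k} pairFactor (κt) |d_j − d_k|²`.
[folklore] -/
theorem entrywiseRigidity_robust (η : ℝ) (hη : 0 < η) :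
    ∃ κ : ℝ, 1 ≤ κ ∧ ∃ C : ℝ, 0 ≤ C ∧ ∃ N₀ : ℕ, ∀ N : ℕ, N₀ ≤ N → ∀ t : ℝ, 0 < t → t ≤ 1 →
      ∀ (D : UN N) (d : Fin N → ℂ), (D : Matrix (Fin N) (Fin N) ℂ) = Matrix.diagonal d → ∀ s : ℕ, s ≤ N →
        haarProbability (UN N) {W : UN N | ∃ R : Matrix (Fin N) (Fin N) ℂ, R.rank ≤ s ∧
          frobSq ((D : Matrix (Fin N) (Fin N) ℂ) * (W : Matrix (Fin N) (Fin N) ℂ) -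
            (W : Matrix (Fin N) (Fin N) ℂ) * (D : Matrix (Fin N) (Fin N) ℂ) - R) ≤ (N : ℝ) * t} ≤
        ENNReal.ofReal (Real.exp ((N : ℝ) ^ 2 * (C - η * Real.log t) +
            (s : ℝ) * N * (Real.log 100 - 2 * Real.log t)) *
          ∏ j : Fin N, ∏ k ∈ Finset.Ioi j, pairFactor (κ * t) (‖d j - d k‖ ^ 2)) := by
  obtain ⟨κ₀, hκ₀, C₀, hC₀, N₀, hER⟩ := entrywiseRigidity_holds η hη
  have hlog18 : 0 ≤ Real.log 18 := Real.log_nonneg (by norm_num)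
  have hlog33 : 0 ≤ Real.log 33 := Real.log_nonneg (by norm_num)
  refine ⟨72 * κ₀, by linarith, C₀ + Real.log 33, by positivity, max N₀ 1, ?_⟩
  intro N hN t ht ht1 D d hD s hs
  have hN₀ : N₀ ≤ N := le_trans (le_max_left _ _) hN
  have hN1 : 0 < N := lt_of_lt_of_le (lt_of_lt_of_le zero_lt_one (le_max_right _ _)) hN
  have hlogt : Real.log t ≤ 0 := Real.log_nonpos ht.le ht1
  have hL : 0 ≤ Real.log 100 - 2 * Real.log t := by
    have := Real.log_nonneg (by norm_num : (1 : ℝ) ≤ 100); linarith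
  -- the product of pair factors and its basic bounds
  set Pf : ℝ := ∏ j : Fin N, ∏ k ∈ Finset.Ioi j, pairFactor (72 * κ₀ * t) (‖d j - d k‖ ^ 2) with hPf
  have hκt : 0 ≤ 72 * κ₀ * t := by positivity
  have hPf0 : 0 ≤ Pf := Finset.prod_nonneg fun j _ => Finset.prod_nonneg fun k _ => pairFactor_nonneg hκt _
  by_cases ht18 : 18 * t ≤ 1
  · -- main case: S7, then (E) at precision 18t
    have h7 := haar_rankRobust_le hs D ht ht1
    rw [plainEvent_eq_ekAction hN1 D t] at h7
    have hE := hER N hN₀ (18 * t) (by positivity) ht18 D d hD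
    refine h7.trans ?_
    rw [const_eq_exp N s ht]
    refine (mul_le_mul' le_rfl hE).trans ?_
    rw [← ENNReal.ofReal_mul (Real.exp_pos _).le]
    refine ENNReal.ofReal_le_ofReal ?_
    -- compare the pair-factor products (monotone in the budget)
    have hprod : ∏ j : Fin N, ∏ k ∈ Finset.Ioi j, pairFactor (κ₀ * (18 * t)) (‖d j - d k‖ ^ 2) ≤ Pf := by
      refine Finset.prod_le_prod (fun j _ => Finset.prod_nonneg fun k _ => pairFactor_nonneg (by positivity) _)
        fun j _ => Finset.prod_le_prod (fun k _ => pairFactor_nonneg (by positivity) _) fun k _ => ?_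
      exact pairFactor_mono (by positivity) (by nlinarith)
    -- compare the exponentials
    have hexp : Real.exp ((N : ℝ) ^ 2 * (C₀ - η * Real.log (18 * t))) ≤
        Real.exp ((N : ℝ) ^ 2 * (C₀ - η * Real.log t)) := by
      refine Real.exp_le_exp.2 (mul_le_mul_of_nonneg_left ?_ (by positivity))
      rw [Real.log_mul (by norm_num) ht.ne']
      nlinarith
    have hE0 : 0 ≤ Real.exp ((N : ℝ) ^ 2 * (C₀ - η * Real.log (18 * t))) := (Real.exp_pos _).le
    calc Real.exp ((N : ℝ) ^ 2 * Real.log 33 + (s : ℝ) * N * (Real.log 100 - 2 * Real.log t)) *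
          (Real.exp ((N : ℝ) ^ 2 * (C₀ - η * Real.log (18 * t))) *
            ∏ j : Fin N, ∏ k ∈ Finset.Ioi j, pairFactor (κ₀ * (18 * t)) (‖d j - d k‖ ^ 2))
        ≤ Real.exp ((N : ℝ) ^ 2 * Real.log 33 + (s : ℝ) * N * (Real.log 100 - 2 * Real.log t)) *
          (Real.exp ((N : ℝ) ^ 2 * (C₀ - η * Real.log t)) * Pf) := by
          refine mul_le_mul_of_nonneg_left ?_ (Real.exp_pos _).le
          exact mul_le_mul hexp hprod (Finset.prod_nonneg fun j _ => Finset.prod_nonneg fun k _ =>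
            pairFactor_nonneg (by positivity) _) (Real.exp_pos _).le
      _ = Real.exp ((N : ℝ) ^ 2 * (C₀ + Real.log 33 - η * Real.log t) +
            (s : ℝ) * N * (Real.log 100 - 2 * Real.log t)) * Pf := by
          rw [← mul_assoc, ← Real.exp_add]; congr 2; ring
  · -- trivial case: every pair factor is `1`, the exponential is `≥ 1`
    push Not at ht18
    have hPf1 : Pf = 1 := by
      refine Finset.prod_eq_one fun j _ => Finset.prod_eq_one fun k _ => ?_
      unfold pairFactor
      rw [if_pos]
      have hj : ‖d j‖ ≤ 1 := by
        have := entry_norm_bound_of_unitary D.2 j j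
        rwa [hD, Matrix.diagonal_apply_eq] at this
      have hk : ‖d k‖ ≤ 1 := by
        have := entry_norm_bound_of_unitary D.2 k k
        rwa [hD, Matrix.diagonal_apply_eq] at this
      have h4 : ‖d j - d k‖ ^ 2 ≤ 4 := by
        have h := norm_sub_le (d j) (d k)
        nlinarith [norm_nonneg (d j - d k)]
      nlinarith
    rw [hPf1, mul_one]
    refine prob_le_one.trans ?_
    rw [← ENNReal.ofReal_one]
    refine ENNReal.ofReal_le_ofReal ?_
    rw [← Real.exp_zero]
    refine Real.exp_le_exp.2 ?_
    have h1 : 0 ≤ (N : ℝ) ^ 2 * (C₀ + Real.log 33 - η * Real.log t) := by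
      refine mul_nonneg (by positivity) ?_
      nlinarith
    have h2 : 0 ≤ (s : ℝ) * N * (Real.log 100 - 2 * Real.log t) := by positivity
    linarith

/-! ### (Ψ_rob): rank-robust pair small ball -/

/-- **Rank-robust pair small ball (Ψ_rob), packaged.**  For every `η > 0` there are `C ≥ 0`, `N₀` such that for `N ≥ N₀`, `0 < t ≤ 1`
and `s ≤ N`: `ekHaar 2 N {U : ∃ R, rank R ≤ s, ‖[U₀,U₁] − R‖_F² ≤ N t} ≤ exp(N²(C − η log t) + sN(log 100 − 2 log t)) · t^{C(N,2)}`.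
[folklore] -/
theorem pairSmallBall_robust (η : ℝ) (hη : 0 < η) :
    ∃ C : ℝ, 0 ≤ C ∧ ∃ N₀ : ℕ, ∀ N : ℕ, N₀ ≤ N → ∀ t : ℝ, 0 < t → t ≤ 1 → ∀ s : ℕ, s ≤ N →
      ekHaar 2 N {U : EKConfig 2 N | ∃ R : Matrix (Fin N) (Fin N) ℂ, R.rank ≤ s ∧
          frobSq (ekComm U 0 1 - R) ≤ (N : ℝ) * t} ≤
        ENNReal.ofReal (Real.exp ((N : ℝ) ^ 2 * (C - η * Real.log t) +
          (s : ℝ) * N * (Real.log 100 - 2 * Real.log t)) * t ^ N.choose 2) := by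
  obtain ⟨C₀, hC₀, N₀, hPSB⟩ := pairSmallBall_of_entrywiseRigidity entrywiseRigidity_holds η hη
  have hlog18 : 0 ≤ Real.log 18 := Real.log_nonneg (by norm_num)
  have hlog33 : 0 ≤ Real.log 33 := Real.log_nonneg (by norm_num)
  refine ⟨C₀ + Real.log 18 + Real.log 33, by positivity, max N₀ 1, ?_⟩
  intro N hN t ht ht1 s hs
  have hN₀ : N₀ ≤ N := le_trans (le_max_left _ _) hN
  have hN1 : 0 < N := lt_of_lt_of_le (lt_of_lt_of_le zero_lt_one (le_max_right _ _)) hN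
  have hlogt : Real.log t ≤ 0 := Real.log_nonpos ht.le ht1
  have hL : 0 ≤ Real.log 100 - 2 * Real.log t := by
    have := Real.log_nonneg (by norm_num : (1 : ℝ) ≤ 100); linarith
  have htm : 0 ≤ t ^ N.choose 2 := by positivity
  by_cases ht18 : 18 * t ≤ 1
  · have h8 := ekHaar_two_rankRobust_le_ekAction hN1 hs ht ht1
    have hP := hPSB N hN₀ (18 * t) (by positivity) ht18
    refine h8.trans ?_
    rw [const_eq_exp N s ht]
    refine (mul_le_mul' le_rfl hP).trans ?_
    rw [← ENNReal.ofReal_mul (Real.exp_pos _).le]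
    refine ENNReal.ofReal_le_ofReal ?_
    have hexp : Real.exp ((N : ℝ) ^ 2 * (C₀ - η * Real.log (18 * t))) ≤
        Real.exp ((N : ℝ) ^ 2 * (C₀ - η * Real.log t)) := by
      refine Real.exp_le_exp.2 (mul_le_mul_of_nonneg_left ?_ (by positivity))
      rw [Real.log_mul (by norm_num) ht.ne']
      nlinarith
    have hpow : (18 * t) ^ N.choose 2 ≤ Real.exp ((N : ℝ) ^ 2 * Real.log 18) * t ^ N.choose 2 := by
      rw [mul_pow]
      exact mul_le_mul_of_nonneg_right (eighteen_pow_choose_two_le N) htm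
    calc Real.exp ((N : ℝ) ^ 2 * Real.log 33 + (s : ℝ) * N * (Real.log 100 - 2 * Real.log t)) *
          (Real.exp ((N : ℝ) ^ 2 * (C₀ - η * Real.log (18 * t))) * (18 * t) ^ N.choose 2)
        ≤ Real.exp ((N : ℝ) ^ 2 * Real.log 33 + (s : ℝ) * N * (Real.log 100 - 2 * Real.log t)) *
          (Real.exp ((N : ℝ) ^ 2 * (C₀ - η * Real.log t)) * (Real.exp ((N : ℝ) ^ 2 * Real.log 18) * t ^ N.choose 2)) := by
          refine mul_le_mul_of_nonneg_left ?_ (Real.exp_pos _).le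
          exact mul_le_mul hexp hpow (by positivity) (Real.exp_pos _).le
      _ = Real.exp ((N : ℝ) ^ 2 * (C₀ + Real.log 18 + Real.log 33 - η * Real.log t) +
            (s : ℝ) * N * (Real.log 100 - 2 * Real.log t)) * t ^ N.choose 2 := by
          rw [← mul_assoc, ← mul_assoc, ← Real.exp_add, ← Real.exp_add]; congr 2; ring
  · push Not at ht18
    refine prob_le_one.trans ?_
    rw [← ENNReal.ofReal_one]
    refine ENNReal.ofReal_le_ofReal ?_
    -- `t^{C(N,2)} ≥ exp(N² log t) ≥ exp(−N² log 18)`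
    have hlogt18 : -Real.log 18 ≤ Real.log t := by
      have : Real.log (1 / 18) ≤ Real.log t := Real.log_le_log (by norm_num) (by linarith)
      rwa [one_div, Real.log_inv] at this
    have hpow : Real.exp (-((N : ℝ) ^ 2 * Real.log 18)) ≤ t ^ N.choose 2 := by
      refine le_trans (Real.exp_le_exp.2 ?_) (exp_sq_mul_log_le_pow_choose_two N ht ht1)
      nlinarith [sq_nonneg (N : ℝ)]
    calc (1 : ℝ) = Real.exp (((N : ℝ) ^ 2 * (C₀ + Real.log 18 + Real.log 33 - η * Real.log t) +
            (s : ℝ) * N * (Real.log 100 - 2 * Real.log t)) - ((N : ℝ) ^ 2 * (C₀ + Real.log 18 + Real.log 33 - η * Real.log t) +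
            (s : ℝ) * N * (Real.log 100 - 2 * Real.log t))) := by rw [sub_self, Real.exp_zero]
      _ ≤ Real.exp ((N : ℝ) ^ 2 * (C₀ + Real.log 18 + Real.log 33 - η * Real.log t) +
            (s : ℝ) * N * (Real.log 100 - 2 * Real.log t)) * Real.exp (-((N : ℝ) ^ 2 * Real.log 18)) := by
          rw [← Real.exp_add]
          refine Real.exp_le_exp.2 ?_
          have h1 : 0 ≤ (N : ℝ) ^ 2 * (C₀ + Real.log 33 - η * Real.log t) := by
            refine mul_nonneg (by positivity) ?_; nlinarith
          have h2 : 0 ≤ (s : ℝ) * N * (Real.log 100 - 2 * Real.log t) := by positivity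
          nlinarith
      _ ≤ _ := mul_le_mul_of_nonneg_left hpow (Real.exp_pos _).le

end RankRobust

end Summit.QuantumFields.YangMills.Theorems.EguchiKawaiDirectionLadder

end
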